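import Mathlib
import HarnessLib
import Summits.HubbardSuperconductivity.HubbardSuperconductivity.Theorems.KLProgrammePerturbedFermiCurveCausticCountWindows
import Summits.HubbardSuperconductivity.HubbardSuperconductivity.Theorems.KLProgrammePerturbedFermiCurveCausticNearTangent

/-!
# Route `KLProgramme` — ENGINE child (stmt-HubbardSuperconductivity-20437 `KLRegimeEngineV17F2`): the INTERSECTION COUNT of the frame's Fermi curve with a
# translate AWAY FROM THE COOPER POINT (step (T2)-caustic; design note HOME/hubbard-kl-k3c2-p2/TWO-SHELL-FRAME-PORT.md §6–§8)

Cell `gate-hubbard-kl`, seat hubbard-kl-k3c2-p2 g15.  Frame twin of p1b's `klsd_zeros_card_le_awayFromCooper`: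
**`zeros_card_le_awayFromCooper_frame`** — `p = perturbedFermiRadius δ_K ν·dir`, transfer `v` NOT `R₀`-close to `2πℤ²`; then
`#{z ∈ [θ₀, θ₀ + 2π] : E(p(z) − v) = ν} ≤ 2π/ℓ + 97`: zeros `ℓ`-far from every bad critical point (`G′ = 0`, `|G| ≤ η`) are `ℓ`-separated
(`klsk_exists_critical_between`, `klsk_finite_ncard_le_of_separated`, slope bound `abs_transCurve_deriv_le`); a bad critical point is odd-aligned
(`nearTangent_near_caustic_momentum`), so the other zeros sit in the `ρ₂`-window of one of `≤ 16` caustic translates in reach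
(`int_mem_quad_of_abs_sub_lt_two`), `≤ 6` each (`nearCaustic_zeros_card_le_six_frame`).
Everything is PROVED; no definitions, no named facts; nothing asserts any stub or superconductivity.
References: DECOMP App. E Lemma E.3; FST II App. B [cite: FeldmanSalmhoferTrubowitz1998]; BGM 2006 §2.7 [cite: BenfattoGiulianiMastropietro2006].
-/

noncomputable section

namespace Summit.HubbardSuperconductivity.HubbardSuperconductivity.Theorems.PerturbedFermiCurve

set_option linter.dupNamespace false -- summit = problem name (single-conjunct summit), D-0017

open Real Set MeasureTheory
open Literature.MathematicalPhysics.QuantumLattice Literature.MathematicalPhysics.QuantumLattice.BandSectorCounting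
open Literature.MathematicalPhysics.QuantumLattice.FermiRG
open Summit.HubbardSuperconductivity.HubbardSuperconductivity.Theorems.DispersionFlow
open Summit.HubbardSuperconductivity.HubbardSuperconductivity.Theorems.KLRegimeSplit

/-! ## The count away from the Cooper point (canonical root selection) -/

section Frame

variable {a b : ℝ} (B : BandBounds a b) {K : TrigPolyC4v} {κ₀ κ₁ : ℝ}
  (hδ : ∀ k : Fin 2 → ℝ, (∀ i, |k i| ≤ π) → |(fun k : Fin 2 → ℝ => -K.eval k) k| ≤ κ₀)
  (hκ : ∀ k : Fin 2 → ℝ, (∀ i, |k i| ≤ π) → ‖fderiv ℝ (fun k : Fin 2 → ℝ => -K.eval k) k‖ ≤ κ₁) (hκ₁ : κ₁ < B.Dtmin)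
  {μ Kc r₀ g₀ w : ℝ} (hG : GeomConstants (frameLevel μ K) Kc r₀ g₀ w) {ν : ℝ} (hν : |ν - μ| < r₀)
include B hδ hκ hκ₁ hG hν

/-- **The intersection count away from the Cooper point** (frame twin of `klsd_zeros_card_le_awayFromCooper`).  `p = perturbedFermiRadius δ_K ν·dir`,
transfer `v` NOT `R₀`-close to `2πℤ²`; `ℓ > 0` with `Kc√2S_E·ℓ ≤ η` and `ν ± (κ₀ + η)` admissible; the bad-point radius `ρ₁(η) = R(0, η) ≤ R₀` and
`ρ₁(η) + 2S_E ℓ ≤ ρ₂ < 2π`, `ρ₂/(√2 u_min) < 2`, and `G″ ≥ c > 0` wherever `2p − v` is `(ρ₂ + 2S_E W)`-close to a lattice point.  Then the zeros of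
`E(p(·) − v) − ν` in a period number `≤ 2π/ℓ + 97`. [cite: FeldmanSalmhoferTrubowitz1998, App. B] -/
theorem zeros_card_le_awayFromCooper_frame {v : Fin 2 → ℝ} {η ℓ ρ₂ c R₀ : ℝ} (θ₀ : ℝ)
    (hlo : a ≤ ν - κ₀ - η) (hhi : ν + κ₀ + η ≤ b) (hℓ : 0 < ℓ)
    (hηℓ : Kc * (Real.sqrt 2 * (B.smax + κ₁ * (π * Real.sqrt 2 + 2 * B.smax) / (B.Dtmin - κ₁))) * ℓ ≤ η)
    (hfar : ∀ m : Fin 2 → ℤ, ∃ i, R₀ < |v i + m i * (2 * π)|)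
    (hR : (η + B.smax * B.Dtmin * ((π * Kc * η / (B.Dtmin - κ₁) ^ 2) * (4 + κ₁) / (B.umin * w))) / (B.Dtmin - κ₁) ≤ R₀)
    (hρ₂ : (η + B.smax * B.Dtmin * ((π * Kc * η / (B.Dtmin - κ₁) ^ 2) * (4 + κ₁) / (B.umin * w))) / (B.Dtmin - κ₁) +
        2 * (B.smax + κ₁ * (π * Real.sqrt 2 + 2 * B.smax) / (B.Dtmin - κ₁)) * ℓ ≤ ρ₂)
    (hρ₂π : ρ₂ < 2 * π) (hσ : ρ₂ / (Real.sqrt 2 * B.umin) < 2) (hc : 0 < c)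
    (hcwin : ∀ (m : Fin 2 → ℤ) (θ : ℝ), (∀ i, |2 * (perturbedFermiRadius (fun k : Fin 2 → ℝ => -K.eval k) ν θ • dir θ) i - v i - m i * (2 * π)| ≤
        ρ₂ + 2 * (B.smax + κ₁ * (π * Real.sqrt 2 + 2 * B.smax) / (B.Dtmin - κ₁)) * (π * (ρ₂ / (Real.sqrt 2 * B.umin)))) →
      c ≤ fderiv ℝ (fderiv ℝ (frameLevel μ K)) (WithLp.toLp 2 (perturbedFermiRadius (fun k : Fin 2 → ℝ => -K.eval k) ν θ • dir θ - v))
            (WithLp.toLp 2 ![VXE (perturbedFermiRadius (fun k : Fin 2 → ℝ => -K.eval k) ν) θ, VYE (perturbedFermiRadius (fun k : Fin 2 → ℝ => -K.eval k) ν) θ])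
            (WithLp.toLp 2 ![VXE (perturbedFermiRadius (fun k : Fin 2 → ℝ => -K.eval k) ν) θ, VYE (perturbedFermiRadius (fun k : Fin 2 → ℝ => -K.eval k) ν) θ]) +
        fderiv ℝ (frameLevel μ K) (WithLp.toLp 2 (perturbedFermiRadius (fun k : Fin 2 → ℝ => -K.eval k) ν θ • dir θ - v))
          (WithLp.toLp 2 ![deriv (deriv (perturbedFermiRadius (fun k : Fin 2 → ℝ => -K.eval k) ν)) θ * Real.cos θ -
                2 * deriv (perturbedFermiRadius (fun k : Fin 2 → ℝ => -K.eval k) ν) θ * Real.sin θ -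
                perturbedFermiRadius (fun k : Fin 2 → ℝ => -K.eval k) ν θ * Real.cos θ,
              deriv (deriv (perturbedFermiRadius (fun k : Fin 2 → ℝ => -K.eval k) ν)) θ * Real.sin θ +
                2 * deriv (perturbedFermiRadius (fun k : Fin 2 → ℝ => -K.eval k) ν) θ * Real.cos θ -
                perturbedFermiRadius (fun k : Fin 2 → ℝ => -K.eval k) ν θ * Real.sin θ])) :
    ∃ Z : Finset ℝ, (Z.card : ℝ) ≤ 2 * π / ℓ + 97 ∧
      ∀ z ∈ Icc θ₀ (θ₀ + 2 * π),
        sqDispersion (perturbedFermiRadius (fun k : Fin 2 → ℝ => -K.eval k) ν z • dir z - v) +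
            -K.eval (perturbedFermiRadius (fun k : Fin 2 → ℝ => -K.eval k) ν z • dir z - v) = ν → z ∈ Z := by
  classical
  set δK : (Fin 2 → ℝ) → ℝ := fun k : Fin 2 → ℝ => -K.eval k with hδK
  set u := perturbedFermiRadius δK ν with hudef
  set SE := B.smax + κ₁ * (π * Real.sqrt 2 + 2 * B.smax) / (B.Dtmin - κ₁) with hSE
  set f := frameLevel μ K with hf
  have hπ := Real.pi_pos
  have hκ₀ : 0 ≤ κ₀ := by
    have h := hδ (fun _ => 0) (fun i => by simp [Real.pi_pos.le])
    exact (abs_nonneg _).trans h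
  have hKc : 0 ≤ Kc := le_trans (norm_nonneg _) (hG.norm_iteratedFDeriv_le (0 : Momentum) 0 (by norm_num))
  have hη : 0 ≤ η := by
    have hδs' : ContDiff ℝ 2 δK := contDiff_frameShift_toLp K
    have : 0 ≤ Kc * (Real.sqrt 2 * SE) * ℓ := by
      have hSE0 : 0 ≤ SE := by
        have hD : 0 < B.Dtmin - κ₁ := sub_pos.2 hκ₁
        have hκ₁0 : 0 ≤ κ₁ := le_trans (norm_nonneg _) (hκ (fun _ => 0) (fun i => by simp [Real.pi_pos.le]))
        have := B.smax_pos
        positivity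
      positivity
    linarith
  have hlo' : a ≤ ν - κ₀ := by linarith
  have hhi' : ν + κ₀ ≤ b := by linarith
  have hδc : Continuous δK := (contDiff_frameShift_toLp K (m := 0)).continuous
  have hδs : ContDiff ℝ 2 δK := contDiff_frameShift_toLp K
  have hu : ∀ θ, IsBandFermiRadius (ν - δK (u θ • dir θ)) θ (u θ) := isBandFermiRadius_perturbedFermiRadius B hδc hδ hlo' hhi'
  have hper : Function.Periodic u (2 * π) := fun θ => perturbedFermiRadius_add_two_pi δK ν θ
  have h2ne : (2 : WithTop ℕ∞) ≠ 0 := by norm_num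
  have hu2 : ContDiff ℝ 2 u := contDiff_of_isRoot B hδs h2ne hδ hlo' hhi' hκ hκ₁ hu
  have hud : ∀ z, DifferentiableAt ℝ u z := fun z => (hu2.differentiable h2ne) z
  -- the level function and its derivative
  set G : ℝ → ℝ := fun z => sqDispersion (u z • dir z - v) + -K.eval (u z • dir z - v) - ν with hGdef
  set G' : ℝ → ℝ := fun z => fderiv ℝ f (WithLp.toLp 2 (u z • dir z - v)) (WithLp.toLp 2 ![VXE u z, VYE u z]) with hG'
  have hGfun : G = fun z => f (WithLp.toLp 2 (u z • dir z - v)) + (μ - ν) := by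
    funext z
    simp only [hGdef, hf, frameLevel_toLp, frameShift_toLp]
    ring
  have hGd : ∀ t, HasDerivAt G (G' t) t := fun t => by
    rw [hGfun]
    exact (hasDerivAt_frameLevel_transCurve μ K (hud t) v).add_const (μ - ν)
  have hM : ∀ t, |G' t| ≤ Kc * (Real.sqrt 2 * SE) := fun t => abs_transCurve_deriv_le B hδ hlo' hhi' hκ hκ₁ hu hG t v
  set P := Icc θ₀ (θ₀ + 2 * π) with hP
  -- the far zeros are `ℓ`-separated
  set Zfar : Set ℝ := {z ∈ P | sqDispersion (u z • dir z - v) + -K.eval (u z • dir z - v) = ν ∧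
      ∀ c ∈ P, G' c = 0 → |G c| ≤ η → ℓ ≤ |z - c|} with hZfar
  have hfar_sep : ∀ z ∈ Zfar, ∀ z' ∈ Zfar, z < z' → ℓ ≤ z' - z := by
    intro z hz z' hz' hzz'
    by_contra hlt
    push Not at hlt
    have hGz : G z = 0 := by
      show sqDispersion (u z • dir z - v) + -K.eval (u z • dir z - v) - ν = 0; rw [hz.2.1, sub_self]
    have hGz' : G z' = 0 := by
      show sqDispersion (u z' • dir z' - v) + -K.eval (u z' • dir z' - v) - ν = 0; rw [hz'.2.1, sub_self]
    obtain ⟨c, hc', hc0, hGc⟩ := klsk_exists_critical_between hGd hM hzz' hGz hGz'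
    have hcP : c ∈ P := ⟨le_trans hz.1.1 hc'.1.le, le_trans hc'.2.le hz'.1.2⟩
    have hM0 : 0 ≤ Kc * (Real.sqrt 2 * SE) := (abs_nonneg _).trans (hM 0)
    have hGcη : |G c| ≤ η :=
      hGc.trans ((mul_le_mul_of_nonneg_left hlt.le hM0).trans hηℓ)
    have hfarz := hz.2.2 c hcP hc0 hGcη
    rw [abs_of_neg (by linarith [hc'.1] : z - c < 0)] at hfarz
    linarith [hc'.2]
  obtain ⟨hZfar_fin, hZfar_card⟩ :=
    klsk_finite_ncard_le_of_separated hℓ (by linarith : θ₀ ≤ θ₀ + 2 * π) (fun z hz => hz.1) hfar_sep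
  rw [show θ₀ + 2 * π - θ₀ = 2 * π by ring] at hZfar_card
  -- the near zeros: per caustic translate
  have hsix : ∀ m : Fin 2 → ℤ, ∃ Z : Finset ℝ, Z.card ≤ 6 ∧
      ∀ z ∈ Icc θ₀ (θ₀ + 2 * π), sqDispersion (u z • dir z - v) + -K.eval (u z • dir z - v) = ν →
        (∀ i, |2 * (u z • dir z) i - v i - m i * (2 * π)| ≤ ρ₂) → z ∈ Z :=
    fun m => nearCaustic_zeros_card_le_six_frame B hδ hlo' hhi' hκ hκ₁ hu hper v m θ₀ hc hσ (hcwin m)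
  choose Zm hZm_card hZm_mem using hsix
  -- the translates in reach
  set n0 : ℤ := ⌊-v 0 / (2 * π)⌋ with hn0
  set n1 : ℤ := ⌊-v 1 / (2 * π)⌋ with hn1
  set S0 : Finset ℤ := {n0 - 1, n0, n0 + 1, n0 + 2} with hS0
  set S1 : Finset ℤ := {n1 - 1, n1, n1 + 1, n1 + 2} with hS1
  set Mfin : Finset (Fin 2 → ℤ) := (S0 ×ˢ S1).image (fun mm : ℤ × ℤ => (![mm.1, mm.2] : Fin 2 → ℤ)) with hMfin
  have hS0card : S0.card ≤ 4 := by
    rw [hS0]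
    refine (Finset.card_insert_le _ _).trans ?_
    refine Nat.succ_le_succ ((Finset.card_insert_le _ _).trans ?_)
    exact Nat.succ_le_succ ((Finset.card_insert_le _ _).trans (by simp))
  have hS1card : S1.card ≤ 4 := by
    rw [hS1]
    refine (Finset.card_insert_le _ _).trans ?_
    refine Nat.succ_le_succ ((Finset.card_insert_le _ _).trans ?_)
    exact Nat.succ_le_succ ((Finset.card_insert_le _ _).trans (by simp))
  have hMcard : Mfin.card ≤ 16 := by
    rw [hMfin]
    refine Finset.card_image_le.trans ?_
    rw [Finset.card_product]
    calc S0.card * S1.card ≤ 4 * 4 := Nat.mul_le_mul hS0card hS1card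
      _ = 16 := by norm_num
  set Znear : Finset ℝ := Mfin.biUnion (fun m => Zm m) with hZnear
  have hZnear_card : Znear.card ≤ 96 := by
    calc Znear.card ≤ ∑ m ∈ Mfin, (Zm m).card := Finset.card_biUnion_le
      _ ≤ ∑ _m ∈ Mfin, 6 := Finset.sum_le_sum (fun m _ => hZm_card m)
      _ = Mfin.card * 6 := by rw [Finset.sum_const, smul_eq_mul]
      _ ≤ 16 * 6 := by gcongr
      _ = 96 := by norm_num
  refine ⟨hZfar_fin.toFinset ∪ Znear, ?_, ?_⟩
  · have hcu := Finset.card_union_le hZfar_fin.toFinset Znear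
    have h1' : (hZfar_fin.toFinset.card : ℝ) ≤ 2 * π / ℓ + 1 := by
      rw [← Set.ncard_eq_toFinset_card Zfar hZfar_fin]; exact hZfar_card
    have h2' : (Znear.card : ℝ) ≤ 96 := by exact_mod_cast hZnear_card
    have hc' : ((hZfar_fin.toFinset ∪ Znear).card : ℝ) ≤ hZfar_fin.toFinset.card + Znear.card := by
      exact_mod_cast hcu
    linarith
  · intro z hzP hGz
    by_cases hfarz : ∀ c ∈ P, G' c = 0 → |G c| ≤ η → ℓ ≤ |z - c|
    · apply Finset.mem_union_left
      rw [Set.Finite.mem_toFinset]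
      exact ⟨hzP, hGz, hfarz⟩
    · apply Finset.mem_union_right
      push Not at hfarz
      obtain ⟨cc, hcP, hc0, hGc, hzc⟩ := hfarz
      -- the bad point `cc` is at a caustic translate
      have hslope : |fderiv ℝ f (WithLp.toLp 2 (u cc • dir cc - v)) (WithLp.toLp 2 ![VXE u cc, VYE u cc])| ≤ 0 := by
        have : G' cc = fderiv ℝ f (WithLp.toLp 2 (u cc • dir cc - v)) (WithLp.toLp 2 ![VXE u cc, VYE u cc]) := rfl
        rw [← this, hc0, abs_zero]
      have hlev : |sqDispersion (u cc • dir cc - v) + -K.eval (u cc • dir cc - v) - ν| ≤ η := hGc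
      have hR' : (η + B.smax * B.Dtmin *
          ((π / 2 * 0 / ((B.Dtmin - κ₁) * B.umin) + π * Kc * η / (B.Dtmin - κ₁) ^ 2) * (4 + κ₁) / (B.umin * w))) /
            (B.Dtmin - κ₁) ≤ R₀ := by
        simpa using hR
      obtain ⟨m, hm⟩ := nearTangent_near_caustic_momentum B hδ hκ hκ₁ hG hν cc hlev hslope hlo hhi hfar hR'
      have hm' : ∀ i, |2 * (u cc • dir cc) i - v i - m i * (2 * π)| ≤
          (η + B.smax * B.Dtmin * ((π * Kc * η / (B.Dtmin - κ₁) ^ 2) * (4 + κ₁) / (B.umin * w))) / (B.Dtmin - κ₁) := by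
        intro i; have := hm i; simpa using this
      -- hence `2p(z)` is within `ρ₂` of the same translate
      have hzw : ∀ i, |2 * (u z • dir z) i - v i - m i * (2 * π)| ≤ ρ₂ := by
        intro i
        have hL := abs_curve_sub_le_frame B hδ hlo' hhi' hκ hκ₁ hu z cc i
        have hSE0 : 0 ≤ SE := by
          have h0 := abs_curve_sub_le_frame B hδ hlo' hhi' hκ hκ₁ hu (cc + 1) cc 0
          rw [show cc + 1 - cc = (1 : ℝ) by ring, abs_one, mul_one] at h0
          exact (abs_nonneg _).trans h0
        have hL' : |(u z • dir z) i - (u cc • dir cc) i| ≤ SE * ℓ := hL.trans (mul_le_mul_of_nonneg_left hzc.le hSE0)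
        obtain ⟨a1, a2⟩ := abs_le.1 hL'
        obtain ⟨b1, b2⟩ := abs_le.1 (hm' i)
        rw [abs_le]; constructor <;> linarith
      -- the translate is one of the sixteen in reach
      have h2π : (0 : ℝ) < 2 * π := by positivity
      have hnear : ∀ i, |-v i / (2 * π) - m i| < 2 := by
        intro i
        have hX : |(u z • dir z) i| < π := abs_apply_lt_pi_of_shifted B hδ hlo' hhi' (hu z) i
        obtain ⟨hX1, hX2⟩ := abs_lt.1 hX
        obtain ⟨hw1, hw2⟩ := abs_le.1 (hzw i)
        have hlt : |-v i - m i * (2 * π)| < 2 * (2 * π) := by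
          rw [abs_lt]; constructor <;> linarith
        have e : -v i / (2 * π) - m i = (-v i - m i * (2 * π)) / (2 * π) := by field_simp
        rw [e, abs_div, abs_of_pos h2π, div_lt_iff₀ h2π]
        exact hlt
      have hm0 : m 0 ∈ S0 := int_mem_quad_of_abs_sub_lt_two (hnear 0)
      have hm1 : m 1 ∈ S1 := int_mem_quad_of_abs_sub_lt_two (hnear 1)
      have hmM : m ∈ Mfin := by
        rw [hMfin, Finset.mem_image]
        refine ⟨(m 0, m 1), Finset.mem_product.2 ⟨hm0, hm1⟩, ?_⟩
        funext i; fin_cases i <;> rfl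
      rw [hZnear, Finset.mem_biUnion]
      exact ⟨m, hmM, hZm_mem m z hzP hGz hzw⟩

end Frame

end Summit.HubbardSuperconductivity.HubbardSuperconductivity.Theorems.PerturbedFermiCurve

end
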